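import Mathlib
import Summits.ValiantsHypothesis.ValiantsHypothesis.Theorems.DivisionGapTriangularDimersDivisionEasyDefs
import Summits.ValiantsHypothesis.ValiantsHypothesis.Theorems.DivisionGapZeroOneTransferStubRhombusKasteleynAux1

/-!
# Crux `DivisionGap.ZeroOneTransfer` (stmt-ValiantsHypothesis-5066), line `charged-uncharged` —
registered stub `stub_rhombusKasteleyn`: THE RHOMBUS IS KASTELEYN

From the Pick-parity statement of the neighbouring stub `stub_pickParity` (taken verbatim as the
hypothesis `hPick`): for every `n`, the rhombus `R_n` of the triangular lattice (vertices
`Fin n × Fin n`, adjacency `AdjR` of `Theorems/DivisionGapTriangularDimersDivisionEasyDefs`) carries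
an integer skew sign function `ε`, nonzero exactly on the edges, with the COMBINATORIAL KASTELEYN
PROPERTY: every fixed-point-free permutation `σ` along edges all of whose cycles are even has
`sign σ · Π_v ε v (σ v) = 1`.

`ε u v = E (crd u) (crd v)` for the orientation `E` of support file 1
(`stub_rhombusKasteleyn_orientation`) and the coordinate map `crd (i, j) = (i, j) ∈ ℤ × ℤ`.
Proof: factor over the cycles of `σ` (`RhombusKasteleyn.sign_mul_prod_eq_one`): it suffices that
every cycle contributes `-1`.  A 2-cycle `{u, w}` gives `ε u w · ε w u = -(±1)² = -1`.  For a cycle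
of length `ℓ ≥ 4` through `v₀` (`RhombusKasteleyn.prod_walk_eq_neg_one`), the closed walk
`W j = crd (σ^j v₀)` is simple and lies in the box `[0, n-1]²`, whose lattice points off the walk —
the other vertices — are paired along the other even cycles of `σ` (`exists_pairing`); so `hPick`
gives `shoelace(W) ≡ ℓ + 2 (mod 4)`, while the local identity of support file 1 gives
`2ℓ - Σ_j E (W j) (W (j+1)) ≡ shoelace(W) (mod 4)`; hence `Σ_j E (W j) (W (j+1)) ≡ ℓ - 2 (mod 4)`,
an odd number of the `ℓ` signs are `-1`, and the cycle contributes `-1`.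
[cite: Kasteleyn1961] [cite: Valiant1980, §3 Thm. 2]
-/

set_option linter.dupNamespace false

open Summit.ValiantsHypothesis.ValiantsHypothesis.Theorems.TriangularDimersDivisionEasy.Shuffling (AdjR)

namespace Summit.ValiantsHypothesis.ValiantsHypothesis.Theorems.DivisionGapZeroOneTransfer

namespace RhombusKasteleyn

open Finset Equiv.Perm

/-! #### Products of `±1` -/

/-- A product of `ℓ` signs is `(-1)^A` where the signs sum to `ℓ - 2A`. [folklore] -/
theorem exists_prod_eq_neg_one_pow (e : ℕ → ℤ) (ℓ : ℕ) (he : ∀ j < ℓ, e j = 1 ∨ e j = -1) :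
    ∃ A : ℕ, ∏ j ∈ range ℓ, e j = (-1) ^ A ∧ ∑ j ∈ range ℓ, e j = (ℓ : ℤ) - 2 * A := by
  induction ℓ with
  | zero => exact ⟨0, by simp⟩
  | succ m ih =>
    obtain ⟨A, hp, hs⟩ := ih fun j hj => he j (by omega)
    rcases he m (by omega) with h | h
    · exact ⟨A, by rw [prod_range_succ, hp, h, mul_one], by rw [sum_range_succ, hs, h]; push_cast; ring⟩
    · exact ⟨A + 1, by rw [prod_range_succ, hp, h, pow_succ],
        by rw [sum_range_succ, hs, h]; push_cast; ring⟩

/-- A product of `ℓ` signs whose sum is `≡ ℓ - 2 (mod 4)` equals `-1` (an odd number of `-1`'s).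
[folklore] -/
theorem prod_eq_neg_one (e : ℕ → ℤ) (ℓ : ℕ) (he : ∀ j < ℓ, e j = 1 ∨ e j = -1)
    (h : (4 : ℤ) ∣ (ℓ : ℤ) - 2 - ∑ j ∈ range ℓ, e j) : ∏ j ∈ range ℓ, e j = -1 := by
  obtain ⟨A, hp, hs⟩ := exists_prod_eq_neg_one_pow e ℓ he
  rw [hs] at h
  have hA : Odd A := by
    obtain ⟨k, hk⟩ := h
    rw [Nat.odd_iff]
    omega
  rw [hp, hA.neg_one_pow]

/-! #### The rhombus in coordinates -/

section Coordinates

variable {n : ℕ} (crd : Fin n × Fin n → ℤ × ℤ)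
  (hcrd : ∀ x, crd x = (((x.1 : ℕ) : ℤ), ((x.2 : ℕ) : ℤ)))
include hcrd

/-- The tree's adjacency `AdjR` of the rhombus is the step relation in coordinates. [folklore] -/
theorem adjR_iff_step (u v : Fin n × Fin n) :
    AdjR u v ↔ (crd v = crd u + (1, 0) ∨ crd u = crd v + (1, 0) ∨ crd v = crd u + (0, 1) ∨
      crd u = crd v + (0, 1) ∨ crd v = crd u + (1, -1) ∨ crd u = crd v + (1, -1)) := by
  simp only [AdjR, hcrd, Prod.mk_add_mk, Prod.mk.injEq]
  omega

/-- The coordinate map is injective. [folklore] -/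
theorem crd_injective {u v : Fin n × Fin n} (h : crd u = crd v) : u = v := by
  simp only [hcrd, Prod.mk.injEq, Nat.cast_inj] at h
  exact Prod.ext (Fin.ext h.1) (Fin.ext h.2)

/-- The coordinates of a vertex lie in the box `[0, n-1]²`. [folklore] -/
theorem crd_mem_box (x : Fin n × Fin n) :
    (0 : ℤ) ≤ (crd x).1 ∧ (crd x).1 ≤ (n : ℤ) - 1 ∧ (0 : ℤ) ≤ (crd x).2 ∧ (crd x).2 ≤ (n : ℤ) - 1 := by
  have h1 := x.1.isLt
  have h2 := x.2.isLt
  simp only [hcrd]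
  omega

/-- Every lattice point of the box `[0, n-1]²` is a vertex of the rhombus. [folklore] -/
theorem exists_crd_eq (u : ℤ × ℤ) (h1 : (0 : ℤ) ≤ u.1) (h2 : u.1 ≤ (n : ℤ) - 1) (h3 : (0 : ℤ) ≤ u.2)
    (h4 : u.2 ≤ (n : ℤ) - 1) : ∃ x : Fin n × Fin n, crd x = u := by
  refine ⟨(⟨u.1.toNat, by omega⟩, ⟨u.2.toNat, by omega⟩), ?_⟩
  rw [hcrd]
  ext <;> simp only <;> omega

/-! #### A cycle of length `≥ 4` contributes `-1` -/

/-- **A cycle of length `≥ 4` contributes `-1`.**  Under the Pick-parity statement `hPick` of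
`stub_pickParity`: for a sign function `E` on `ℤ × ℤ` supported on the steps, `±1` there, with the
local identity `hloc` (as produced by `stub_rhombusKasteleyn_orientation`), a fixed-point-free `σ`
on `Fin n × Fin n` along steps with all cycles even, and `v₀` on a cycle of length `ℓ ≥ 4`, the
signs along the walk `W j = crd (σ^j v₀)` multiply to `-1`. [cite: Kasteleyn1961] -/
theorem prod_walk_eq_neg_one
    (hPick : ∀ (ℓ : ℕ) (v : ℕ → ℤ × ℤ), 4 ≤ ℓ → Even ℓ → (∀ j, v (j + ℓ) = v j) →
      (∀ j, v (j + 1) = v j + (1, 0) ∨ v j = v (j + 1) + (1, 0) ∨ v (j + 1) = v j + (0, 1) ∨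
        v j = v (j + 1) + (0, 1) ∨ v (j + 1) = v j + (1, -1) ∨ v j = v (j + 1) + (1, -1)) →
      (∀ i j, i < ℓ → j < ℓ → v i = v j → i = j) →
      ∀ (P₀ P₁ Q₀ Q₁ : ℤ), (∀ j, P₀ ≤ (v j).1 ∧ (v j).1 ≤ P₁ ∧ Q₀ ≤ (v j).2 ∧ (v j).2 ≤ Q₁) →
      ∀ g : ℤ × ℤ → ℤ × ℤ,
        (∀ u : ℤ × ℤ, P₀ ≤ u.1 → u.1 ≤ P₁ → Q₀ ≤ u.2 → u.2 ≤ Q₁ → (∀ j, v j ≠ u) →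
          (g u = u + (1, 0) ∨ u = g u + (1, 0) ∨ g u = u + (0, 1) ∨ u = g u + (0, 1) ∨
            g u = u + (1, -1) ∨ u = g u + (1, -1)) ∧ (∀ j, v j ≠ g u) ∧ g (g u) = u) →
        (4 : ℤ) ∣ (∑ j ∈ Finset.range ℓ, ((v j).1 * (v (j + 1)).2 - (v (j + 1)).1 * (v j).2)) - (ℓ + 2))
    (E : ℤ × ℤ → ℤ × ℤ → ℤ)
    (hsupp : ∀ p q, E p q ≠ 0 ↔ (q = p + (1, 0) ∨ p = q + (1, 0) ∨ q = p + (0, 1) ∨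
      p = q + (0, 1) ∨ q = p + (1, -1) ∨ p = q + (1, -1)))
    (hval : ∀ p q, (q = p + (1, 0) ∨ p = q + (1, 0) ∨ q = p + (0, 1) ∨ p = q + (0, 1) ∨
      q = p + (1, -1) ∨ p = q + (1, -1)) → E p q = 1 ∨ E p q = -1)
    (hloc : ∀ (ℓ : ℕ) (W : ℕ → ℤ × ℤ), (∀ j, W (j + 1) = W j + (1, 0) ∨ W j = W (j + 1) + (1, 0) ∨
      W (j + 1) = W j + (0, 1) ∨ W j = W (j + 1) + (0, 1) ∨ W (j + 1) = W j + (1, -1) ∨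
      W j = W (j + 1) + (1, -1)) → W ℓ = W 0 → (4 : ℤ) ∣ ∑ j ∈ Finset.range ℓ,
        (2 - E (W j) (W (j + 1)) - ((W j).1 * (W (j + 1)).2 - (W (j + 1)).1 * (W j).2)))
    (σ : Equiv.Perm (Fin n × Fin n)) (hσ : ∀ v, σ v ≠ v) (hadj : ∀ v, E (crd v) (crd (σ v)) ≠ 0)
    (heven : ∀ c ∈ σ.cycleFactorsFinset, Even #c.support)
    (v₀ : Fin n × Fin n) (h4 : 4 ≤ #(σ.cycleOf v₀).support)
    (W : ℕ → ℤ × ℤ) (hW : ∀ j, W j = crd ((σ ^ j) v₀)) :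
    ∏ j ∈ range #(σ.cycleOf v₀).support, E (W j) (W (j + 1)) = -1 := by
  set ℓ := #(σ.cycleOf v₀).support with hℓ
  have hv₀ : σ v₀ ≠ v₀ := hσ v₀
  have hevenℓ : Even ℓ := heven _ (cycleOf_mem_cycleFactorsFinset_iff.mpr (mem_support.mpr hv₀))
  -- the steps of the walk
  have hstep : ∀ j, W (j + 1) = W j + (1, 0) ∨ W j = W (j + 1) + (1, 0) ∨
      W (j + 1) = W j + (0, 1) ∨ W j = W (j + 1) + (0, 1) ∨ W (j + 1) = W j + (1, -1) ∨
      W j = W (j + 1) + (1, -1) := fun j => by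
    rw [hW, hW, pow_succ', Equiv.Perm.mul_apply]
    exact (hsupp _ _).mp (hadj _)
  -- periodicity, simplicity, the box
  have hper : ∀ j, W (j + ℓ) = W j := fun j => by rw [hW, hW, pow_add_card_apply]
  have hsimple : ∀ i j, i < ℓ → j < ℓ → W i = W j → i = j := fun i j hi hj h => by
    rw [hW, hW] at h
    exact pow_apply_injOn σ hv₀ hi hj (crd_injective crd hcrd h)
  have hbox : ∀ j, (0 : ℤ) ≤ (W j).1 ∧ (W j).1 ≤ (n : ℤ) - 1 ∧ (0 : ℤ) ≤ (W j).2 ∧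
      (W j).2 ≤ (n : ℤ) - 1 := fun j => by
    rw [hW]; exact crd_mem_box crd hcrd _
  -- on / off the walk
  have hon : ∀ x j, W j = crd x → σ.SameCycle v₀ x := fun x j h => by
    rw [hW] at h
    rw [← crd_injective crd hcrd h]
    exact sameCycle_pow_right.mpr (SameCycle.refl σ v₀)
  have hoff : ∀ x, (∀ j, W j ≠ crd x) → ¬ σ.SameCycle v₀ x := fun x hx hsc => by
    obtain ⟨i, -, hi⟩ := hsc.exists_pow_eq_of_mem_support (mem_support.mpr hv₀)
    exact hx i (by rw [hW, hi])
  -- the pairing of the vertices along the even cycles, and the decoding of box points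
  obtain ⟨g, hg⟩ := exists_pairing σ hσ heven
  haveI : Nonempty (Fin n × Fin n) := ⟨v₀⟩
  have hdec : ∀ u : ℤ × ℤ, (0 : ℤ) ≤ u.1 → u.1 ≤ (n : ℤ) - 1 → (0 : ℤ) ≤ u.2 → u.2 ≤ (n : ℤ) - 1 →
      ∃ x : Fin n × Fin n, crd x = u := fun u => exists_crd_eq crd hcrd u
  choose! dec hdec using hdec
  -- the topological input
  have hP := hPick ℓ W h4 hevenℓ hper hstep hsimple 0 ((n : ℤ) - 1) 0 ((n : ℤ) - 1) hbox
    (fun u => crd (g (dec u))) ?_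
  · -- arithmetic: local identity + Pick parity ⇒ an odd number of `-1`
    have hlocW := hloc ℓ W hstep (by rw [← zero_add ℓ, hper 0])
    apply prod_eq_neg_one _ ℓ fun j _ => hval _ _ (hstep j)
    rw [sum_sub_distrib, sum_sub_distrib, sum_const, card_range, nsmul_eq_mul] at hlocW
    omega
  · -- the pairing hypothesis of `hPick`
    intro u hu1 hu2 hu3 hu4 huoff
    have hx : crd (dec u) = u := hdec u hu1 hu2 hu3 hu4
    set x := dec u with hx'
    have hxoff : ¬ σ.SameCycle v₀ x := hoff x (by rw [hx]; exact huoff)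
    obtain ⟨hgx, hgg, hsc⟩ := hg x
    refine ⟨?_, ?_, ?_⟩
    · show _ = u + (1, 0) ∨ u = _ + (1, 0) ∨ _ = u + (0, 1) ∨ u = _ + (0, 1) ∨
        _ = u + (1, -1) ∨ u = _ + (1, -1)
      rw [← hx]
      rcases hgx with h | h
      · rw [h]; exact (hsupp _ _).mp (hadj x)
      · have := (hsupp _ _).mp (hadj (g x))
        rw [h] at this
        exact step_symm this
    · intro j hj
      exact hxoff ((hon (g x) j hj).trans hsc.symm)
    · show crd (g (dec (crd (g x)))) = u
      obtain ⟨b1, b2, b3, b4⟩ := crd_mem_box crd hcrd (g x)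
      have h2 : crd (dec (crd (g x))) = crd (g x) := hdec _ b1 b2 b3 b4
      rw [crd_injective crd hcrd h2, hgg, hx]

end Coordinates

end RhombusKasteleyn

open Finset Equiv.Perm RhombusKasteleyn in
/-- **Registered stub `stub_rhombusKasteleyn` — THE RHOMBUS IS KASTELEYN** (crux
stmt-ValiantsHypothesis-5066, line `charged-uncharged`, stub B3).  From the Pick-parity statement
of stub B2 (`stub_pickParity`, the hypothesis): for every `n` the rhombus `R_n` of the triangular
lattice (vertices `Fin n × Fin n`, adjacency `AdjR`) carries an integer skew sign function `ε`,
nonzero exactly on the edges, such that every fixed-point-free permutation `σ` along edges with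
all cycles even has `sign σ · Π_v ε v (σ v) = 1`.  Orientation (`v = (i, j)`, `i` = column):
`(i,j) → (i+1,j)`; `(i,j) → (i,j+1)` iff `i` even; the antidiagonal `{(i,j+1), (i+1,j)}` points to
its even-column end.  Proof: factor over cycles; a 2-cycle gives `-(±1)² = -1`; a cycle of length
`ℓ ≥ 4` gives `-1` by `RhombusKasteleyn.prod_walk_eq_neg_one` (local identity
`2·#against + ℓ ≡ shoelace (mod 4)` + Pick parity `shoelace ≡ ℓ + 2 (mod 4)`, the other even
cycles pairing the off-cycle vertices). [cite: Kasteleyn1961] [cite: Valiant1980, §3 Thm. 2] -/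
theorem stub_rhombusKasteleyn :
    (∀ (ℓ : ℕ) (v : ℕ → ℤ × ℤ), 4 ≤ ℓ → Even ℓ → (∀ j, v (j + ℓ) = v j) →
      (∀ j, v (j + 1) = v j + (1, 0) ∨ v j = v (j + 1) + (1, 0) ∨ v (j + 1) = v j + (0, 1) ∨
        v j = v (j + 1) + (0, 1) ∨ v (j + 1) = v j + (1, -1) ∨ v j = v (j + 1) + (1, -1)) →
      (∀ i j, i < ℓ → j < ℓ → v i = v j → i = j) →
      ∀ (P₀ P₁ Q₀ Q₁ : ℤ), (∀ j, P₀ ≤ (v j).1 ∧ (v j).1 ≤ P₁ ∧ Q₀ ≤ (v j).2 ∧ (v j).2 ≤ Q₁) →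
      ∀ g : ℤ × ℤ → ℤ × ℤ,
        (∀ u : ℤ × ℤ, P₀ ≤ u.1 → u.1 ≤ P₁ → Q₀ ≤ u.2 → u.2 ≤ Q₁ → (∀ j, v j ≠ u) →
          (g u = u + (1, 0) ∨ u = g u + (1, 0) ∨ g u = u + (0, 1) ∨ u = g u + (0, 1) ∨
            g u = u + (1, -1) ∨ u = g u + (1, -1)) ∧ (∀ j, v j ≠ g u) ∧ g (g u) = u) →
        (4 : ℤ) ∣ (∑ j ∈ Finset.range ℓ, ((v j).1 * (v (j + 1)).2 - (v (j + 1)).1 * (v j).2)) - (ℓ + 2)) →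
    ∀ n : ℕ, ∃ ε : Fin n × Fin n → Fin n × Fin n → ℤ,
      (∀ u v, ε u v = -ε v u) ∧ (∀ u v, ε u v ≠ 0 ↔ AdjR u v) ∧
      ∀ σ : Equiv.Perm (Fin n × Fin n), (∀ v, σ v ≠ v) → (∀ v, ε v (σ v) ≠ 0) →
        (∀ c ∈ σ.cycleFactorsFinset, Even c.support.card) →
        (Equiv.Perm.sign σ : ℤ) * ∏ v, ε v (σ v) = 1 := by
  intro hPick n
  obtain ⟨E, hskew, hsupp, hval, hloc⟩ := stub_rhombusKasteleyn_orientation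
  -- the coordinate map
  obtain ⟨crd, hcrd⟩ : ∃ crd : Fin n × Fin n → ℤ × ℤ, ∀ x, crd x = (((x.1 : ℕ) : ℤ), ((x.2 : ℕ) : ℤ)) :=
    ⟨_, fun x => rfl⟩
  refine ⟨fun u v => E (crd u) (crd v), fun u v => hskew _ _,
    fun u v => (hsupp _ _).trans (adjR_iff_step crd hcrd u v).symm, ?_⟩
  intro σ hσ hadj heven
  refine sign_mul_prod_eq_one σ hσ (fun u v => E (crd u) (crd v)) heven fun c hc => ?_
  -- a cycle `c` of `σ`: `c = σ.cycleOf v₀`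
  obtain ⟨v₀, hv₀⟩ := (mem_cycleFactorsFinset_iff.mp hc).1.nonempty_support
  have hc' := cycle_is_cycleOf hv₀ hc
  subst hc'
  have hℓ := heven _ hc
  rw [prod_support_cycleOf σ (hσ v₀)]
  simp_rw [← Equiv.Perm.mul_apply, ← pow_succ']
  have h2 : 2 ≤ #(σ.cycleOf v₀).support := two_le_card_support_cycleOf_iff.mpr (hσ v₀)
  rcases Nat.lt_or_ge #(σ.cycleOf v₀).support 4 with hlt | h4
  · -- a 2-cycle: `ε u w · ε w u = -(±1)² = -1`
    have hℓ2 : #(σ.cycleOf v₀).support = 2 := by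
      obtain ⟨k, hk⟩ := hℓ; omega
    have hsq : (σ ^ 2) v₀ = v₀ := by
      have := pow_mod_card_support_cycleOf_self_apply σ 2 v₀
      rwa [hℓ2, Nat.mod_self, pow_zero, Equiv.Perm.one_apply, eq_comm] at this
    rw [hℓ2, prod_range_succ, prod_range_succ, prod_range_zero, one_mul, hsq, pow_zero, pow_one,
      Equiv.Perm.one_apply, hskew (crd (σ v₀)) (crd v₀)]
    have h1 : E (crd v₀) (crd (σ v₀)) ≠ 0 := hadj v₀
    rcases hval _ _ ((hsupp _ _).mp h1) with h | h <;> rw [h] <;> norm_num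
  · -- a cycle of length `≥ 4`
    exact prod_walk_eq_neg_one crd hcrd hPick E hsupp hval hloc σ hσ hadj heven v₀ h4
      (fun j => crd ((σ ^ j) v₀)) fun j => rfl

end Summit.ValiantsHypothesis.ValiantsHypothesis.Theorems.DivisionGapZeroOneTransfer
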